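import Literature.Probability.LatticeModels.ModifiedSimonInequality
import Literature.Probability.LatticeModels.BackboneKernel
import Mathlib.Combinatorics.SimpleGraph.Trails
import Mathlib.Combinatorics.SimpleGraph.Walk.Counting
import HarnessLib

/-!
# Fisher's self-avoiding-walk bound for Ising correlations on an arbitrary finite graph

Topic `Literature/Probability/LatticeModels`. Theorem-only file (no definition, no named fact, no sorry).
Companion of `IsingSAWBound.lean` (the `ℤ^d` form with step words): the same inequality for the
nearest-neighbour Ising model (free boundary condition, zero field, `β ≥ 0`) in a finite volume `Λ` of an
arbitrary locally finite graph `G`, the self-avoiding walks being the graph PATHS (Mathlib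
`SimpleGraph.Walk.IsPath`):

* `hteSum_pair_le_pathSum_mul`, `isingTwoPoint_free_le_pathSum` — **Fisher's inequality**
  (M. E. Fisher, Phys. Rev. 162 (1967) 480–485): for `a ≠ z` in `Λ`,
  `⟨σ_aσ_z⟩^∅_{Λ;β} ≤ ∑_{p : path a → z, |p| ≤ |ℰ_Λ|} tanh(β)^{|p|}`
  (van der Waerden's high-temperature expansion `isingTwoPoint_free_eq_hteSum_div`; an edge set with
  `∂F = {a, z}` connects `a` to `z` (`cconn_of_csources_eq`), so contains the edges `W` of a path `a → z`
  (Mathlib `Walk.bypass`); a path has `∂W = {a} ∆ {z}` (Mathlib `IsTrail.even_countP_edges_iff`), so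
  `F ↦ F ∖ W` maps injectively into `{∂ = ∅}` with `t^{|F|} = t^{|p|} t^{|F ∖ W|}`).
  On a graph of maximal degree `Δ` the paths of length `n` from `a` number at most `Δ(Δ-1)^{n-1}`, so the
  bound decays like `((Δ-1) tanh β)^{dist(a,z)}` as soon as `(Δ-1) tanh β < 1` (Fisher's `tanh β_c ≥ 1/(q-1)`
  for coordination number `q`); that counting step is not part of this file.

References: M. E. Fisher, Phys. Rev. 162 (1967) 480 [Fisher1967]; N. Madras, G. Slade, *The Self-Avoiding Walk*
(1993), §1.2 [MadrasSlade1993].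
-/

noncomputable section

open Finset
open scoped symmDiff

namespace Literature.Probability.LatticeModels

variable {V : Type*} [DecidableEq V] (G : SimpleGraph V) [G.LocallyFinite]

/-! ### Part 1. The edge set of a path has odd vertices `{a} ∆ {z}` -/

omit [G.LocallyFinite] in
/-- For a trail `p : a → z` and `x ∈ Λ ⊇ {a, z}`: `x` has odd degree in the edge set of `p` iff `x ∈ {a} ∆ {z}`
(Mathlib's `IsTrail.even_countP_edges_iff`). [folklore] -/
private theorem oddVerts_edges_toFinset {a z : V} {p : G.Walk a z} (hp : p.IsPath) {Λ : Finset V}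
    (ha : a ∈ Λ) (hz : z ∈ Λ) : oddVerts Λ p.edges.toFinset = {a} ∆ {z} := by
  have htr : p.IsTrail := hp.isTrail
  ext x
  simp only [oddVerts, mem_filter, mem_symmDiff, mem_singleton]
  have hcount : #(p.edges.toFinset.filter fun e => x ∈ e) = p.edges.countP (fun e => x ∈ e) := by
    rw [List.countP_eq_length_filter, ← List.toFinset_card_of_nodup (htr.edges_nodup.filter _), List.toFinset_filter]
    congr 1
    ext e
    simp
  rw [hcount]
  have hev := htr.even_countP_edges_iff x
  constructor
  · rintro ⟨hx, hodd⟩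
    have hne : ¬Even (p.edges.countP fun e => x ∈ e) := Nat.not_even_iff_odd.2 hodd
    rw [hev] at hne
    have haz : a ≠ z := fun h => hne (fun h' => absurd h h')
    have hor : x = a ∨ x = z := by
      by_contra hcon
      exact hne (fun _ => ⟨fun h => hcon (Or.inl h), fun h => hcon (Or.inr h)⟩)
    rcases hor with hxa | hxz
    · exact Or.inl ⟨hxa, fun hxz => haz (hxa.symm.trans hxz)⟩
    · exact Or.inr ⟨hxz, fun hxa => haz (hxa.symm.trans hxz)⟩
  · rintro (⟨rfl, hxz⟩ | ⟨rfl, hxa⟩)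
    · refine ⟨ha, Nat.not_even_iff_odd.1 fun hev' => ?_⟩
      exact ((hev.1 hev') (fun h => hxz h)).1 rfl
    · refine ⟨hz, Nat.not_even_iff_odd.1 fun hev' => ?_⟩
      exact ((hev.1 hev') (fun h => hxa h.symm)).2 rfl

/-! ### Part 2. An edge set with odd vertices `{a, z}` contains a path `a → z` -/

/-- For `F ⊆ ℰ_Λ` with `∂F = {a} ∆ {z}`, `a ≠ z`, there is a `G`-path `a → z` with all its edges in `F`, of
length `≤ |F|` (handshake + loop erasure). [folklore] -/
private theorem exists_path_of_oddVerts_eq {Λ : Finset V} {F : Finset (Sym2 V)} (hF : F ⊆ edgesIn G Λ) {a z : V}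
    (haz : a ≠ z) (hodd : oddVerts Λ F = {a} ∆ {z}) :
    ∃ p : G.Walk a z, p.IsPath ∧ p.edges.toFinset ⊆ F ∧ p.length ≤ F.card := by
  classical
  set m : edgesIn G Λ → ℕ := fun e => if (e : Sym2 V) ∈ F then 1 else 0 with hm
  have hoddE : oddEdges G Λ m = F := by
    ext e
    rw [oddEdges, Finset.mem_map]
    constructor
    · rintro ⟨e', he', rfl⟩
      have hodd' : Odd (m e') := (mem_filter.1 he').2
      by_contra hnot
      have hnot' : (e' : Sym2 V) ∉ F := hnot
      have hzero : m e' = 0 := by rw [hm]; exact if_neg hnot'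
      rw [hzero] at hodd'
      exact (Nat.not_odd_iff_even.2 (by decide)) hodd'
    · intro he
      refine ⟨⟨e, hF he⟩, mem_filter.2 ⟨mem_univ _, ?_⟩, rfl⟩
      have hone : m ⟨e, hF he⟩ = 1 := by rw [hm]; exact if_pos he
      rw [hone]; exact odd_one
  have hsrc : csources G Λ m = {a} ∆ {z} := by rw [csources_eq_oddVerts, hoddE, hodd]
  have hconn := cconn_of_csources_eq (G := G) (Λ := Λ) haz hsrc
  -- reachability in the graph with edge set `F`
  have hreach : (SimpleGraph.fromEdgeSet (↑F : Set (Sym2 V))).Reachable a z := by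
    rw [SimpleGraph.reachable_iff_reflTransGen]
    have hstep : ∀ x y : V, (∃ e : edgesIn G Λ, (e : Sym2 V) ∈ edgesIn G Λ ∧ 0 < m e ∧ (e : Sym2 V) = s(x, y)) →
        (SimpleGraph.fromEdgeSet (↑F : Set (Sym2 V))).Adj x y := by
      rintro x y ⟨e, -, hpos, hes⟩
      have heF : (e : Sym2 V) ∈ F := by
        by_contra hnot
        have hzero : m e = 0 := by rw [hm]; exact if_neg hnot
        omega
      rw [SimpleGraph.fromEdgeSet_adj]
      refine ⟨by rw [Finset.mem_coe, ← hes]; exact heF, ?_⟩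
      have hadj : G.Adj x y := by
        have := (mem_edgesIn_iff.1 e.2).1
        rw [hes] at this
        exact (SimpleGraph.mem_edgeSet _).1 this
      exact hadj.ne
    unfold CConn at hconn
    clear hsrc hodd hoddE haz
    clear_value m
    induction hconn with
    | refl => exact Relation.ReflTransGen.refl
    | tail _ hbc ih => exact ih.tail (hstep _ _ hbc)
  obtain ⟨q⟩ := hreach
  -- loop erasure, transfer to `G`
  set r := q.bypass with hr
  have hrF : ∀ e ∈ r.edges, e ∈ F := fun e he => by
    have := r.edges_subset_edgeSet he
    revert this
    refine Sym2.ind (fun x y hxy => ?_) e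
    exact Finset.mem_coe.1 ((SimpleGraph.fromEdgeSet_adj _).1 hxy).1
  have hrG : ∀ e ∈ r.edges, e ∈ G.edgeSet := fun e he => (mem_edgesIn_iff.1 (hF (hrF e he))).1
  refine ⟨r.transfer G hrG, q.bypass_isPath.transfer _, ?_, ?_⟩
  · intro e he
    rw [List.mem_toFinset, SimpleGraph.Walk.edges_transfer] at he
    exact hrF e he
  · rw [SimpleGraph.Walk.length_transfer, ← SimpleGraph.Walk.length_edges]
    have hnd : r.edges.Nodup := q.bypass_isPath.isTrail.edges_nodup
    rw [← List.toFinset_card_of_nodup hnd]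
    exact card_le_card fun e he => hrF e (List.mem_toFinset.1 he)

/-! ### Part 3. Fisher's inequality -/

/-- **Fisher's inequality for the high-temperature sums on a finite graph**: for `t ≥ 0` and `a ≠ z`,
`g_Λ({a} ∆ {z}) ≤ (∑_{p : path a → z, |p| ≤ |ℰ_Λ|} t^{|p|}) · g_Λ(∅)`.
[cite: Fisher1967, Phys. Rev. 162 (1967) 480, the correlation bound by self-avoiding-walk generating functions] -/
theorem hteSum_pair_le_pathSum_mul (Λ : Finset V) {t : ℝ} (ht : 0 ≤ t) {a z : V} (haz : a ≠ z) :
    hteSum G Λ t ({a} ∆ {z}) ≤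
      (∑ p ∈ (G.finsetWalkLengthLT (#(edgesIn G Λ) + 1) a z).filter (fun p => p.IsPath), t ^ p.length) *
        hteSum G Λ t ∅ := by
  classical
  set E := edgesIn G Λ with hE
  set N := #E + 1 with hN
  set PW := (G.finsetWalkLengthLT N a z).filter (fun p => p.IsPath) with hPW
  set P : Finset (Finset (Sym2 V)) := E.powerset.filter (fun F => oddVerts Λ F = {a} ∆ {z}) with hP
  set P0 : Finset (Finset (Sym2 V)) := E.powerset.filter (fun F => oddVerts Λ F = ∅) with hP0
  have hg : hteSum G Λ t ({a} ∆ {z}) = ∑ F ∈ P, t ^ #F := rfl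
  have hg0 : hteSum G Λ t ∅ = ∑ F ∈ P0, t ^ #F := rfl
  -- Step 1: union bound over the paths contained in `F`
  have step1 : ∑ F ∈ P, t ^ #F ≤ ∑ F ∈ P, ∑ p ∈ PW, if p.edges.toFinset ⊆ F then t ^ #F else 0 := by
    refine sum_le_sum fun F hF => ?_
    obtain ⟨hFE, hodd⟩ := mem_filter.1 hF
    rw [mem_powerset] at hFE
    obtain ⟨p, hp, hpF, hlen⟩ := exists_path_of_oddVerts_eq G hFE haz hodd
    have hpPW : p ∈ PW := by
      rw [hPW, mem_filter, SimpleGraph.mem_finsetWalkLengthLT_iff]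
      exact ⟨by have := card_le_card hFE; omega, hp⟩
    refine le_trans (le_of_eq (by rw [if_pos hpF])) (single_le_sum (f := fun p' : G.Walk a z =>
      if p'.edges.toFinset ⊆ F then t ^ #F else 0) (fun p' _ => by split_ifs <;> positivity) hpPW)
  -- Step 2: for a fixed path, `F ↦ F ∖ W` is an injection into `{∂ = ∅}`
  have step2 : ∀ p ∈ PW, ∑ F ∈ P, (if p.edges.toFinset ⊆ F then t ^ #F else 0) ≤ t ^ p.length * ∑ F ∈ P0, t ^ #F := by
    intro p hp
    have hpath : p.IsPath := (mem_filter.1 hp).2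
    set W := p.edges.toFinset with hW
    have hcardW : #W = p.length := by
      rw [hW, List.toFinset_card_of_nodup hpath.isTrail.edges_nodup, SimpleGraph.Walk.length_edges]
    rw [← sum_filter]
    set Q := P.filter (fun F => W ⊆ F) with hQ
    have hsplit : ∑ F ∈ Q, t ^ #F = t ^ p.length * ∑ F ∈ Q, t ^ #(F \ W) := by
      rw [mul_sum]
      refine sum_congr rfl fun F hF => ?_
      have hWF : W ⊆ F := (mem_filter.1 hF).2
      rw [← pow_add, ← hcardW, add_comm, card_sdiff_add_card_eq_card hWF]
    rw [hsplit]
    refine mul_le_mul_of_nonneg_left ?_ (pow_nonneg ht _)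
    have hinj : Set.InjOn (fun F => F \ W) (Q : Set (Finset (Sym2 V))) := by
      intro F hF F' hF' hFF'
      have hWF : W ⊆ F := (mem_filter.1 (Finset.mem_coe.1 hF)).2
      have hWF' : W ⊆ F' := (mem_filter.1 (Finset.mem_coe.1 hF')).2
      have : F \ W ∪ W = F' \ W ∪ W := by simp only at hFF'; rw [hFF']
      rwa [sdiff_union_of_subset hWF, sdiff_union_of_subset hWF'] at this
    have himg : ∑ F' ∈ Q.image (fun F => F \ W), t ^ #F' = ∑ F ∈ Q, t ^ #(F \ W) :=
      sum_image fun F hF F' hF' h => hinj (Finset.mem_coe.2 hF) (Finset.mem_coe.2 hF') h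
    rw [← himg]
    refine sum_le_sum_of_subset_of_nonneg (fun F' hF' => ?_) fun _ _ _ => pow_nonneg ht _
    obtain ⟨F, hF, rfl⟩ := mem_image.1 hF'
    obtain ⟨hFP, hWF⟩ := mem_filter.1 hF
    obtain ⟨hFE, hodd⟩ := mem_filter.1 hFP
    rw [mem_powerset] at hFE
    refine mem_filter.2 ⟨mem_powerset.2 (sdiff_subset.trans hFE), ?_⟩
    have ha : a ∈ Λ := by
      have : a ∈ oddVerts Λ F := by rw [hodd, mem_symmDiff]; exact Or.inl ⟨mem_singleton_self a, by simpa using haz⟩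
      exact oddVerts_subset Λ F this
    have hz : z ∈ Λ := by
      have : z ∈ oddVerts Λ F := by rw [hodd, mem_symmDiff]; exact Or.inr ⟨mem_singleton_self z, by simpa using haz.symm⟩
      exact oddVerts_subset Λ F this
    have hF_eq : F = F \ W ∪ W := (sdiff_union_of_subset hWF).symm
    have hsplit' : oddVerts Λ F = oddVerts Λ (F \ W) ∆ oddVerts Λ W := by
      conv_lhs => rw [hF_eq]
      exact oddVerts_union_of_disjoint Λ sdiff_disjoint
    have hW' : oddVerts Λ W = {a} ∆ {z} := oddVerts_edges_toFinset G hpath ha hz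
    have : oddVerts Λ (F \ W) = oddVerts Λ F ∆ oddVerts Λ W := by
      rw [hsplit', symmDiff_assoc, symmDiff_self, symmDiff_bot]
    rw [this, hodd, hW', symmDiff_self]
    rfl
  -- Step 3: assemble
  rw [hg, hg0]
  refine step1.trans ?_
  rw [sum_comm]
  calc ∑ p ∈ PW, ∑ F ∈ P, (if p.edges.toFinset ⊆ F then t ^ #F else 0)
      ≤ ∑ p ∈ PW, t ^ p.length * ∑ F ∈ P0, t ^ #F := sum_le_sum step2
    _ = (∑ p ∈ PW, t ^ p.length) * ∑ F ∈ P0, t ^ #F := by rw [sum_mul]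

/-- **Fisher's inequality** (free boundary condition, zero field, `β ≥ 0`) on an arbitrary finite volume
`Λ` of a locally finite graph: for `a ≠ z` in `Λ`,
`⟨σ_aσ_z⟩^∅_{Λ;β} ≤ ∑_{p : path a → z, |p| ≤ |ℰ_Λ|} tanh(β)^{|p|}`.
[cite: Fisher1967, Phys. Rev. 162 (1967) 480, the correlation bound by self-avoiding-walk generating functions] -/
theorem isingTwoPoint_free_le_pathSum {β : ℝ} (hβ : 0 ≤ β) {Λ : Finset V} {a z : V} (ha : a ∈ Λ) (hz : z ∈ Λ)
    (haz : a ≠ z) :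
    isingTwoPoint G Λ β 0 .free a z ≤
      ∑ p ∈ (G.finsetWalkLengthLT (#(edgesIn G Λ) + 1) a z).filter (fun p => p.IsPath), Real.tanh β ^ p.length := by
  classical
  have ht0 : 0 ≤ Real.tanh β := by
    rw [Real.tanh_eq_sinh_div_cosh]; exact div_nonneg (Real.sinh_nonneg_iff.2 hβ) (Real.cosh_pos β).le
  rw [isingTwoPoint_free_eq_hteSum_div G Λ β ha hz, div_le_iff₀ (hteSum_empty_pos G Λ β)]
  exact hteSum_pair_le_pathSum_mul G Λ ht0 haz

end Literature.Probability.LatticeModels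

end
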